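import Literature.AnabelianGeometry.AbsoluteAnabelian.ProfiniteAutGroup
import HarnessLib

/-!
# `Aut(G) ≃ lim_n Aut(G)/A_n` for a topologically finitely generated profinite group: surjectivity, and the inner automorphisms ([SemiAnbd] §0 p. 5)

Mochizuki, *Semi-graphs of anabelioids*, Publ. RIMS **42** (2006), §0 p. 5 [cite: MochizukiSemiAnbd2006, §0 p.5]
(`Aut(G)`, `Out(G)` as topological groups).  Second half of the construction begun in
`ProfiniteAutGroup.lean` (abc-iut cell, GAP row «G-P13-GR», abc-iut-w5-d151 g4):

* SURJECTIVITY of `toProfiniteAut : Aut(G) → lim_n Aut(G)/A_n` (`toProfiniteAut_surjective`): a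
  compatible family of automorphisms of the finite levels is GLUED to a bi-continuous automorphism of
  `G` — at each `g ∈ G` the cosets `rep_n(g)·V_n` are nested, closed and nonempty, so meet (compactness)
  in exactly one point (`⋂ V_n = 1`); the resulting map is a continuous bijective homomorphism of the
  compact Hausdorff group `G`, hence bi-continuous (`glueAut`);
* **`profiniteAutEquiv : contMulAut G ≃* profiniteAut hG`**;
* the inner automorphisms: `conjProfiniteAut hG : G →ₜ* profiniteAut hG` is CONTINUOUS, with CLOSED
  NORMAL range, and injective for centre-free `G` — the topological form of
  "`1 → G → Aut(G) → Out(G) → 1`" for centre-free `G`.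

Nothing here bears on [IUTchIII] Cor. 3.12.
-/

namespace Literature.AnabelianGeometry.AbsoluteAnabelian

open Literature.AnabelianGeometry.EtaleTheta Literature.AnabelianGeometry.SemiGraphs
open Filter Topology
open scoped Pointwise

universe u

/-! ### Surjectivity of `Aut(G) → lim_n Aut(G)/A_n`: gluing a compatible family of automorphisms -/

section Glue

variable {G : Type u} [Group G] [TopologicalSpace G]

/-- A bi-continuous automorphism preserves each characteristic open core, in both directions.
[cite: MochizukiSemiAnbd2006, §0 p.5] -/
theorem apply_mem_charOpenCore_iff (φ : contMulAut G) {n : ℕ} {g : G} :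
    (φ.1 : MulAut G) g ∈ charOpenCore G n ↔ g ∈ charOpenCore G n := by
  constructor
  · intro h
    have := apply_mem_charOpenCore ((φ.1 : MulAut G)⁻¹) φ.2.2 φ.2.1 h
    simpa using this
  · exact apply_mem_charOpenCore (φ.1 : MulAut G) φ.2.1 φ.2.2

variable [IsTopologicalGroup G] [CompactSpace G] {hG : IsTopologicallyFinitelyGenerated G}
  (x : profiniteAut hG)

/-- A representative automorphism of the level-`n` component of `x ∈ lim_n Aut(G)/A_n`.
[cite: MochizukiSemiAnbd2006, §0 p.5] -/
noncomputable def rep (n : ℕ) : contMulAut G := (x.1 n).out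

/-- `rep x n` represents `x n`. [cite: MochizukiSemiAnbd2006, §0 p.5] -/
theorem mk_rep (n : ℕ) : (QuotientGroup.mk (rep x n) : contMulAut G ⧸ autLevelKer G n) = x.1 n :=
  QuotientGroup.out_eq' _

/-- **Compatibility of the representatives**: for `n ≤ m`, `rep x n ≡ rep x m (mod V_n)` pointwise.
[cite: MochizukiSemiAnbd2006, §0 p.5] -/
theorem rep_compat {n m : ℕ} (h : n ≤ m) (g : G) :
    ((rep x n).1 : MulAut G) g⁻¹ * ((rep x m).1 : MulAut G) g ∈ charOpenCore G n := by
  have hx := x.2 n m h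
  rw [← mk_rep x m, autLevelTrans_mk, ← mk_rep x n, eq_comm, QuotientGroup.eq] at hx
  -- `(rep n)⁻¹ * rep m ∈ A_n`; evaluate at `g` and push through `rep n`
  have hg := mem_autLevelKer_iff.mp hx g
  have h1 : (((rep x n)⁻¹ * rep x m).1 : MulAut G) g =
      ((rep x n).1 : MulAut G)⁻¹ (((rep x m).1 : MulAut G) g) := rfl
  have : ((rep x n).1 : MulAut G) (g⁻¹ * (((rep x n)⁻¹ * rep x m).1 : MulAut G) g) =
      ((rep x n).1 : MulAut G) g⁻¹ * ((rep x m).1 : MulAut G) g := by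
    rw [map_mul, map_inv, h1]
    congr 1
    rw [← MulAut.mul_apply, mul_inv_cancel, MulAut.one_apply]
  rw [← this]
  exact (apply_mem_charOpenCore_iff (rep x n)).mpr hg

/-- The nested closed cosets `rep x n (g) · V_n` whose intersection is the value of the glued
automorphism at `g`. [cite: MochizukiSemiAnbd2006, §0 p.5] -/
def glueSet (g : G) (n : ℕ) : Set G := {y | (((rep x n).1 : MulAut G) g)⁻¹ * y ∈ charOpenCore G n}

/-- The cosets are nested. [cite: MochizukiSemiAnbd2006, §0 p.5] -/
theorem glueSet_succ_subset (g : G) (n : ℕ) : glueSet x g (n + 1) ⊆ glueSet x g n := by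
  intro y hy
  have h1 : (((rep x (n + 1)).1 : MulAut G) g)⁻¹ * y ∈ charOpenCore G n :=
    charOpenCore_anti (Nat.le_succ n) hy
  have h2 := rep_compat x (Nat.le_succ n) g
  have : (((rep x n).1 : MulAut G) g)⁻¹ * y =
      (((rep x n).1 : MulAut G) g⁻¹ * ((rep x (n + 1)).1 : MulAut G) g) *
        ((((rep x (n + 1)).1 : MulAut G) g)⁻¹ * y) := by rw [map_inv]; group
  change (((rep x n).1 : MulAut G) g)⁻¹ * y ∈ charOpenCore G n
  rw [this]
  exact (charOpenCore G n).mul_mem h2 h1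

/-- The cosets are nonempty. [cite: MochizukiSemiAnbd2006, §0 p.5] -/
theorem glueSet_nonempty (g : G) (n : ℕ) : (glueSet x g n).Nonempty :=
  ⟨((rep x n).1 : MulAut G) g, by simp [glueSet]⟩

/-- The cosets are closed (for topologically finitely generated `G`: the cores are open subgroups).
[cite: MochizukiSemiAnbd2006, §0 p.5] -/
theorem isClosed_glueSet (hG' : IsTopologicallyFinitelyGenerated G) (g : G) (n : ℕ) :
    IsClosed (glueSet x g n) :=
  ((charOpenCore G n).isClosed_of_isOpen (isOpen_charOpenCore_of_tfg hG' n)).preimage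
    (continuous_const.mul continuous_id)

/-- Two points of all the cosets are congruent modulo every core. [cite: MochizukiSemiAnbd2006, §0 p.5] -/
theorem inv_mul_mem_of_mem_glueSet {g y z : G} {n : ℕ} (hy : y ∈ glueSet x g n) (hz : z ∈ glueSet x g n) :
    y⁻¹ * z ∈ charOpenCore G n := by
  have : y⁻¹ * z = ((((rep x n).1 : MulAut G) g)⁻¹ * y)⁻¹ * ((((rep x n).1 : MulAut G) g)⁻¹ * z) := by
    group
  rw [this]
  exact (charOpenCore G n).mul_mem ((charOpenCore G n).inv_mem hy) hz

/-- **The glued value**: the intersection of the nested compact cosets is nonempty.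
[cite: MochizukiSemiAnbd2006, §0 p.5] -/
theorem exists_mem_iInter_glueSet (g : G) : ∃ y, ∀ n, y ∈ glueSet x g n := by
  have h := IsCompact.nonempty_iInter_of_sequence_nonempty_isCompact_isClosed (glueSet x g)
    (glueSet_succ_subset x g) (glueSet_nonempty x g) (isClosed_glueSet x hG g 0).isCompact
    (isClosed_glueSet x hG g)
  obtain ⟨y, hy⟩ := h
  exact ⟨y, fun n => Set.mem_iInter.mp hy n⟩

variable [TotallyDisconnectedSpace G]

/-- Uniqueness of the glued value. [cite: MochizukiSemiAnbd2006, §0 p.5] -/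
theorem eq_of_forall_mem_glueSet {g y z : G} (hy : ∀ n, y ∈ glueSet x g n) (hz : ∀ n, z ∈ glueSet x g n) :
    y = z := by
  have h : y⁻¹ * z = 1 := eq_one_of_forall_mem_charOpenCore fun n => inv_mul_mem_of_mem_glueSet x (hy n) (hz n)
  rw [← mul_right_inj y⁻¹, h, inv_mul_cancel]

/-- The glued function `g ↦ ⋂_n rep x n (g) · V_n`. [cite: MochizukiSemiAnbd2006, §0 p.5] -/
noncomputable def glueFun (g : G) : G := Classical.choose (exists_mem_iInter_glueSet x g)

omit [TotallyDisconnectedSpace G] in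
/-- Defining property of the glued function: `glueFun x g ≡ rep x n (g) (mod V_n)` for every `n`.
[cite: MochizukiSemiAnbd2006, §0 p.5] -/
theorem glueFun_mem (g : G) (n : ℕ) : glueFun x g ∈ glueSet x g n :=
  Classical.choose_spec (exists_mem_iInter_glueSet x g) n

/-- The glued function is characterised by the cosets. [cite: MochizukiSemiAnbd2006, §0 p.5] -/
theorem glueFun_eq_of_forall_mem {g y : G} (hy : ∀ n, y ∈ glueSet x g n) : glueFun x g = y :=
  eq_of_forall_mem_glueSet x (glueFun_mem x g) hy

/-- **The glued function is multiplicative** (the cores are normal). [cite: MochizukiSemiAnbd2006, §0 p.5] -/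
theorem glueFun_mul (g h : G) : glueFun x (g * h) = glueFun x g * glueFun x h := by
  refine glueFun_eq_of_forall_mem x fun n => ?_
  have hg := glueFun_mem x g n
  have hh := glueFun_mem x h n
  change (((rep x n).1 : MulAut G) (g * h))⁻¹ * (glueFun x g * glueFun x h) ∈ charOpenCore G n
  -- `(φg φh)⁻¹ ψg ψh = [φh⁻¹ (φg⁻¹ ψg) φh] · [φh⁻¹ ψh]`
  have : (((rep x n).1 : MulAut G) (g * h))⁻¹ * (glueFun x g * glueFun x h) =
      ((((rep x n).1 : MulAut G) h)⁻¹ * ((((rep x n).1 : MulAut G) g)⁻¹ * glueFun x g) *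
        (((rep x n).1 : MulAut G) h)) * ((((rep x n).1 : MulAut G) h)⁻¹ * glueFun x h) := by
    rw [map_mul]; group
  rw [this]
  refine (charOpenCore G n).mul_mem ?_ hh
  have := (charOpenCore_normal (Γ := G) n).conj_mem _ hg ((((rep x n).1 : MulAut G) h)⁻¹)
  simpa using this

/-- The glued function as a group homomorphism. [cite: MochizukiSemiAnbd2006, §0 p.5] -/
noncomputable def glueHom : G →* G := MonoidHom.mk' (glueFun x) (glueFun_mul x)

/-- `glueHom` is `glueFun`. [cite: MochizukiSemiAnbd2006, §0 p.5] -/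
@[simp] theorem glueHom_apply (g : G) : glueHom x g = glueFun x g := rfl

omit [TotallyDisconnectedSpace G] in
/-- The glued homomorphism maps each core into itself. [cite: MochizukiSemiAnbd2006, §0 p.5] -/
theorem glueFun_mem_charOpenCore {n : ℕ} {g : G} (hg : g ∈ charOpenCore G n) :
    glueFun x g ∈ charOpenCore G n := by
  have h := glueFun_mem x g n
  have h1 : ((rep x n).1 : MulAut G) g ∈ charOpenCore G n := (apply_mem_charOpenCore_iff _).mpr hg
  have : glueFun x g = ((rep x n).1 : MulAut G) g * ((((rep x n).1 : MulAut G) g)⁻¹ * glueFun x g) := by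
    group
  rw [this]
  exact (charOpenCore G n).mul_mem h1 h

/-- **The glued homomorphism is continuous** (it maps `V_n` into `V_n`, and the cores are a basis).
[cite: MochizukiSemiAnbd2006, §0 p.5] -/
theorem continuous_glueHom : Continuous (glueHom x) := by
  refine continuous_of_continuousAt_one (glueHom x) ?_
  rw [ContinuousAt, map_one]
  intro U hU
  obtain ⟨n, hn⟩ := exists_charOpenCore_subset (G := G) hU
  change (glueHom x) ⁻¹' U ∈ 𝓝 (1 : G)
  refine Filter.mem_of_superset ((isOpen_charOpenCore_of_tfg hG n).mem_nhds (one_mem _)) ?_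
  intro g hg
  exact hn (glueFun_mem_charOpenCore x hg)

/-- **The glued homomorphism is injective.** [cite: MochizukiSemiAnbd2006, §0 p.5] -/
theorem glueHom_injective : Function.Injective (glueHom x) := by
  refine (injective_iff_map_eq_one _).mpr fun g hg => eq_one_of_forall_mem_charOpenCore fun n => ?_
  have h : (((rep x n).1 : MulAut G) g)⁻¹ * glueFun x g ∈ charOpenCore G n := glueFun_mem x g n
  rw [glueHom_apply] at hg
  rw [hg, mul_one] at h
  exact (apply_mem_charOpenCore_iff (rep x n)).mp ((charOpenCore G n).inv_mem_iff.mp h)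

/-- **The glued homomorphism is surjective**: the preimages `(rep x n)⁻¹(y)` form nested cosets whose
intersection is a preimage of `y`. [cite: MochizukiSemiAnbd2006, §0 p.5] -/
theorem glueHom_surjective : Function.Surjective (glueHom x) := by
  intro y
  -- the nested closed cosets `g_n · V_n`, `g_n := (rep x n)⁻¹ y`
  let S : ℕ → Set G := fun n => {z | ((((rep x n).1 : MulAut G)⁻¹) y)⁻¹ * z ∈ charOpenCore G n}
  have hS_anti : ∀ n, S (n + 1) ⊆ S n := by
    intro n z hz
    have h1 : ((((rep x (n + 1)).1 : MulAut G)⁻¹) y)⁻¹ * z ∈ charOpenCore G n :=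
      charOpenCore_anti (Nat.le_succ n) hz
    -- `g_n⁻¹ g_{n+1} ∈ V_n`: push through `rep x n` and use compatibility at `g_{n+1}`
    have h2 : ((((rep x n).1 : MulAut G)⁻¹) y)⁻¹ * (((rep x (n + 1)).1 : MulAut G)⁻¹) y ∈
        charOpenCore G n := by
      rw [← apply_mem_charOpenCore_iff (rep x n), map_mul, map_inv]
      -- `rep n (rep n⁻¹ y) = y` and compatibility at `g := rep (n+1)⁻¹ y`
      set g : G := (((rep x (n + 1)).1 : MulAut G)⁻¹) y with hgdef
      have hy1 : ((rep x n).1 : MulAut G) ((((rep x n).1 : MulAut G)⁻¹) y) = y := by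
        rw [← MulAut.mul_apply, mul_inv_cancel, MulAut.one_apply]
      have hy2 : ((rep x (n + 1)).1 : MulAut G) g = y := by
        rw [hgdef, ← MulAut.mul_apply, mul_inv_cancel, MulAut.one_apply]
      have hc : ((rep x n).1 : MulAut G) g⁻¹ * ((rep x (n + 1)).1 : MulAut G) g ∈ charOpenCore G n :=
        rep_compat x (Nat.le_succ n) g
      rw [hy2, map_inv] at hc
      have hc' := (charOpenCore G n).inv_mem hc
      rw [mul_inv_rev, inv_inv] at hc'
      rw [hy1]
      exact hc'
    have : ((((rep x n).1 : MulAut G)⁻¹) y)⁻¹ * z =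
        (((((rep x n).1 : MulAut G)⁻¹) y)⁻¹ * (((rep x (n + 1)).1 : MulAut G)⁻¹) y) *
          (((((rep x (n + 1)).1 : MulAut G)⁻¹) y)⁻¹ * z) := by group
    change ((((rep x n).1 : MulAut G)⁻¹) y)⁻¹ * z ∈ charOpenCore G n
    rw [this]
    exact (charOpenCore G n).mul_mem h2 h1
  have hS_ne : ∀ n, (S n).Nonempty := fun n => ⟨(((rep x n).1 : MulAut G)⁻¹) y, by simp [S]⟩
  have hS_cl : ∀ n, IsClosed (S n) := fun n =>
    ((charOpenCore G n).isClosed_of_isOpen (isOpen_charOpenCore_of_tfg hG n)).preimage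
      (continuous_const.mul continuous_id)
  obtain ⟨g, hg⟩ := IsCompact.nonempty_iInter_of_sequence_nonempty_isCompact_isClosed S hS_anti hS_ne
    (hS_cl 0).isCompact hS_cl
  refine ⟨g, glueFun_eq_of_forall_mem x fun n => ?_⟩
  -- `y ∈ rep x n (g) · V_n`
  have hgn : ((((rep x n).1 : MulAut G)⁻¹) y)⁻¹ * g ∈ charOpenCore G n := Set.mem_iInter.mp hg n
  change (((rep x n).1 : MulAut G) g)⁻¹ * y ∈ charOpenCore G n
  rw [← (charOpenCore G n).inv_mem_iff, mul_inv_rev, inv_inv, ← apply_mem_charOpenCore_iff (rep x n)] at hgn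
  rw [map_mul, map_inv, ← MulAut.mul_apply, mul_inv_cancel, MulAut.one_apply] at hgn
  exact hgn

/-- The glued automorphism as a multiplicative equivalence. [cite: MochizukiSemiAnbd2006, §0 p.5] -/
noncomputable def glueMulEquiv : MulAut G :=
  MulEquiv.ofBijective (glueHom x) ⟨glueHom_injective x, glueHom_surjective x⟩

/-- `glueMulEquiv` is `glueFun`. [cite: MochizukiSemiAnbd2006, §0 p.5] -/
@[simp] theorem glueMulEquiv_apply (g : G) : glueMulEquiv x g = glueFun x g := rfl

/-- **The glued automorphism is bi-continuous** (a continuous bijection of the compact Hausdorff `G`).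
[cite: MochizukiSemiAnbd2006, §0 p.5] -/
noncomputable def glueAut : contMulAut G :=
  ⟨glueMulEquiv x, continuous_glueHom x,
    (Continuous.homeoOfEquivCompactToT2 (f := (glueMulEquiv x).toEquiv) (continuous_glueHom x)).symm.continuous⟩

/-- **`toProfiniteAut (glueAut x) = x`**: the glued automorphism represents the given compatible family.
[cite: MochizukiSemiAnbd2006, §0 p.5] -/
theorem toProfiniteAut_glueAut : toProfiniteAut hG (glueAut x) = x := by
  refine Subtype.ext (funext fun n => ?_)
  change (QuotientGroup.mk (glueAut x) : contMulAut G ⧸ autLevelKer G n) = x.1 n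
  rw [← mk_rep x n, eq_comm, QuotientGroup.eq, mem_autLevelKer_iff]
  intro g
  -- `g⁻¹ · (rep n)⁻¹ (ψ g) ∈ V_n` ⟸ `(rep n g)⁻¹ ψ g ∈ V_n`
  rw [← apply_mem_charOpenCore_iff (rep x n), map_mul, map_inv]
  have h : (((rep x n).1 : MulAut G) g)⁻¹ * glueFun x g ∈ charOpenCore G n := glueFun_mem x g n
  have h1 : (((rep x n)⁻¹ * glueAut x).1 : MulAut G) g =
      ((rep x n).1 : MulAut G)⁻¹ (((glueAut x).1 : MulAut G) g) := rfl
  have h2 : ((glueAut x).1 : MulAut G) g = glueFun x g := rfl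
  rw [h1, h2, ← MulAut.mul_apply, mul_inv_cancel, MulAut.one_apply]
  exact h

/-- **`Aut(G) → lim_n Aut(G)/A_n` is surjective.** [cite: MochizukiSemiAnbd2006, §0 p.5] -/
theorem toProfiniteAut_surjective : Function.Surjective (toProfiniteAut hG) :=
  fun x => ⟨glueAut x, toProfiniteAut_glueAut x⟩

/-- **`Aut(G) ≃ lim_n Aut(G)/A_n`**: the group of bi-continuous automorphisms of a topologically finitely
generated profinite group IS the profinite group `profiniteAut hG`. [cite: MochizukiSemiAnbd2006, §0 p.5] -/
noncomputable def profiniteAutEquiv : contMulAut G ≃* profiniteAut hG :=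
  MulEquiv.ofBijective (toProfiniteAut hG) ⟨toProfiniteAut_injective hG, toProfiniteAut_surjective⟩

/-- `profiniteAutEquiv` is `toProfiniteAut`. [cite: MochizukiSemiAnbd2006, §0 p.5] -/
@[simp] theorem profiniteAutEquiv_apply (φ : contMulAut G) : profiniteAutEquiv (hG := hG) φ = toProfiniteAut hG φ :=
  rfl

end Glue

/-! ### Inner automorphisms: `G → Aut(G)` is continuous with closed normal image -/

section Inner

variable {G : Type u} [Group G] [TopologicalSpace G] [IsTopologicalGroup G]

/-- The inner automorphism `conj g` as a bi-continuous automorphism. [cite: MochizukiSemiAnbd2006, §0 p.5] -/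
def conjContAut (g : G) : contMulAut G := ⟨MulAut.conj g, innerAut_le_contMulAut G ⟨g, rfl⟩⟩

/-- `conjContAut` is a homomorphism. [cite: MochizukiSemiAnbd2006, §0 p.5] -/
def conjContAutHom : G →* contMulAut G where
  toFun := conjContAut
  map_one' := Subtype.ext (map_one MulAut.conj)
  map_mul' g h := Subtype.ext (map_mul MulAut.conj g h)

/-- `conjContAutHom g` acts as conjugation. [cite: MochizukiSemiAnbd2006, §0 p.5] -/
@[simp] theorem conjContAutHom_apply (g x : G) : ((conjContAutHom g).1 : MulAut G) x = g * x * g⁻¹ := rfl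

/-- The range of `conjContAutHom` is the subgroup of inner automorphisms. [cite: MochizukiSemiAnbd2006, §0 p.5] -/
theorem range_conjContAutHom : (conjContAutHom (G := G)).range = innerContAut G := by
  ext φ
  constructor
  · rintro ⟨g, rfl⟩
    exact ⟨g, rfl⟩
  · rintro ⟨g, hg⟩
    exact ⟨g, Subtype.ext hg⟩

/-- An element of `V_n` acts trivially on `G / V_n` by conjugation: `conj g ∈ A_n` for `g ∈ V_n`.
[cite: MochizukiSemiAnbd2006, §0 p.5] -/
theorem conjContAut_mem_autLevelKer {n : ℕ} {g : G} (hg : g ∈ charOpenCore G n) :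
    conjContAutHom g ∈ autLevelKer G n := by
  haveI := charOpenCore_normal (Γ := G) n
  exact mem_autLevelKer_iff.mpr fun x => outerSemidirectProduct.congr_conj_of_mem hg x

variable [CompactSpace G] (hG : IsTopologicallyFinitelyGenerated G)

/-- **The inner-automorphism map `G → lim_n Aut(G)/A_n` as a CONTINUOUS homomorphism** (each level
component `G → Aut(G)/A_n` kills the open subgroup `V_n`). [cite: MochizukiSemiAnbd2006, §0 p.5] -/
noncomputable def conjProfiniteAut : G →ₜ* profiniteAut hG where
  toMonoidHom := (toProfiniteAut hG).comp conjContAutHom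
  continuous_toFun := by
    letI τ : ∀ n : ℕ, TopologicalSpace (contMulAut G ⧸ autLevelKer G n) := fun _ => ⊥
    haveI hd : ∀ n : ℕ, DiscreteTopology (contMulAut G ⧸ autLevelKer G n) := fun _ => ⟨rfl⟩
    refine continuous_induced_rng.2 (continuous_pi fun n => ?_)
    -- the level-`n` component is a homomorphism to a discrete group with open kernel
    let c : G →* contMulAut G ⧸ autLevelKer G n := (QuotientGroup.mk' _).comp conjContAutHom
    change Continuous c
    refine continuous_of_continuousAt_one c ?_
    rw [ContinuousAt, map_one]
    intro U hU
    change c ⁻¹' U ∈ 𝓝 (1 : G)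
    refine Filter.mem_of_superset ((isOpen_charOpenCore_of_tfg hG n).mem_nhds (one_mem _)) ?_
    intro g hg
    have hc : c g = 1 := (QuotientGroup.eq_one_iff _).mpr (conjContAut_mem_autLevelKer hg)
    change c g ∈ U
    rw [hc]
    exact mem_of_mem_nhds hU

/-- `conjProfiniteAut` is `toProfiniteAut ∘ conj`. [cite: MochizukiSemiAnbd2006, §0 p.5] -/
theorem conjProfiniteAut_apply (g : G) : conjProfiniteAut hG g = toProfiniteAut hG (conjContAutHom g) := rfl

/-- **The image of `G → profiniteAut` is CLOSED** (compact image in a Hausdorff group).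
[cite: MochizukiSemiAnbd2006, §0 p.5] -/
theorem isClosed_range_conjProfiniteAut :
    IsClosed ((conjProfiniteAut hG).toMonoidHom.range : Set (profiniteAut hG)) := by
  have : ((conjProfiniteAut hG).toMonoidHom.range : Set (profiniteAut hG)) = Set.range (conjProfiniteAut hG) := by
    ext x; simp
  rw [this]
  exact (isCompact_range (conjProfiniteAut hG).continuous).isClosed

variable [TotallyDisconnectedSpace G]

/-- The range of `conjProfiniteAut` is the image of the inner automorphisms under `Aut(G) ≃ profiniteAut`.
[cite: MochizukiSemiAnbd2006, §0 p.5] -/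
theorem range_conjProfiniteAut :
    (conjProfiniteAut hG).toMonoidHom.range = (innerContAut G).map (profiniteAutEquiv (hG := hG)).toMonoidHom := by
  rw [← range_conjContAutHom, MonoidHom.map_range]
  rfl

/-- **The image of `G → profiniteAut` is a NORMAL subgroup** (image of the normal subgroup `Inn(G)` under
the isomorphism `Aut(G) ≃ profiniteAut`). [cite: MochizukiSemiAnbd2006, §0 p.5] -/
theorem range_conjProfiniteAut_normal : (conjProfiniteAut hG).toMonoidHom.range.Normal := by
  rw [range_conjProfiniteAut]
  exact Subgroup.Normal.map inferInstance _ (profiniteAutEquiv (hG := hG)).surjective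

/-- For CENTRE-FREE `G`, `G → profiniteAut` is injective. [cite: MochizukiSemiAnbd2006, §0 p.5] -/
theorem conjProfiniteAut_injective (hZ : Subgroup.center G = ⊥) : Function.Injective (conjProfiniteAut hG) := by
  intro g h hgh
  have h1 := toProfiniteAut_injective hG hgh
  have h2 : MulAut.conj g = MulAut.conj h := congrArg (fun φ : contMulAut G => (φ.1 : MulAut G)) h1
  -- `conj (h⁻¹ g) = 1`, so `h⁻¹ g` is central, hence trivial
  have h3 : h⁻¹ * g ∈ Subgroup.center G := by
    have hc : MulAut.conj (h⁻¹ * g) = 1 := by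
      rw [map_mul, map_inv, ← h2, inv_mul_cancel]
    rw [Subgroup.mem_center_iff]
    intro y
    have := DFunLike.congr_fun hc y
    rw [MulAut.conj_apply, MulAut.one_apply] at this
    -- `(h⁻¹ g) y (h⁻¹ g)⁻¹ = y`
    calc y * (h⁻¹ * g) = (h⁻¹ * g) * y * (h⁻¹ * g)⁻¹ * (h⁻¹ * g) := by rw [this]
      _ = h⁻¹ * g * y := by group
  rw [hZ, Subgroup.mem_bot] at h3
  rw [← mul_right_inj h⁻¹, h3, inv_mul_cancel]

end Inner

end Literature.AnabelianGeometry.AbsoluteAnabelian
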